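import Summits.QuantumFields.YangMills.Theorems.UnitScaleTiltProp7FlatHolonomy
import Summits.QuantumFields.YangMills.Theorems.UnitScaleTiltProp7HolRatioPerStep
import Literature.MathematicalPhysics.QuantumFieldTheory.Balaban1983to89.BlockAveragingEMLProp2
import HarnessLib

/-!
# Route `UnitScaleTilt`, crux K1 «MinimiserStabilityRegPr» (stmt-QuantumFields-19200), route-R [RP] curved, the curved N6 row (R-C), transport geometry (i) —
# THE BACKGROUND TOWER'S BOND VARIABLES ARE THE FINE STRAIGHT TRANSPORTERS UP TO THE ACCUMULATED CORRECTION FACTORS: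
# `‖Ū₀^{(k)}(c) − U₀([embIter k c₋ → L^k steps e_c])‖ ≤ θ_k` whenever `θ_0 ≥ 0`, `2a_j + L·θ_j ≤ θ_{j+1}` (`a_j` the size of the level-`j` loop variables)

Cell `ym3-torus`, width seat `ym-ust-20520-w2` (g3).  First lemma of the transport-geometry half of (R-C) (`S_k ↔ A^{U₀}` of ✓ p601741: the pure `LINE`-iterate
transports by tower bonds `Ū₀^{(j)}`, the engine by fine holonomies of `U₀`).  THEOREMS ONLY (0 `def`, 0 `sorry`); `--supports stmt-QuantumFields-19200`, count-neutral.
YM₃ on T³ is a ladder rung (R3), not the Clay problem; nothing here claims the curved N6, S2, P, the crux or the gap.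

THE POINT.  `Ū₀^{(j+1)}(c) = κ_c·axialAvg Ū₀^{(j)}(c)` (definition of (0.4)), `axialAvg Ū₀^{(j)}(c) = Ū₀^{(j)}([emb c₋ → L steps])` (`axialAvg_eq_holAt_walk`), and the
fine straight transporter field `W_k(c) := U₀([embIter k c₋ → L^k steps e_c])` satisfies the same recursion WITHOUT `κ` (★p1's `holAt_walk_of_straightIter`).  Hence with
`dist1 κ ≤ 2a_j` (`dist1_corr_le_two_mul`) and the telescoping of products of unitaries, `θ_{j+1} = 2a_j + L·θ_j` dominates the discrepancy; for the geometric tower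
`a_j = O(εL^{2(j−k)})` this is `θ_k = O(ε∕L)` — k-uniform.

WHAT IS PROVED (ns `…Theorems.Prop7TowerStraightTransport`).
* §1 `norm_holAt_walk_replicate_sub_le` — `‖A(straight m) − B(straight m)‖ ≤ Σ_{t<m}‖A(b_t) − B(b_t)‖` for `SU(N)` fields.
* §2 ★★ `norm_iter_sub_straightIter_le` — the title, for every `k` and every level-`k` bond, under per-level sizes `a j` (`≤ 1/6`, `< δ_N`) and any dominating `θ`.
HONEST SCOPE.  One ingredient of the `S_k ↔ A^{U₀}` comparison (the others: the one-stroke split per level and lattice Stokes on the comb-vs-comb loops).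

References: T. Bałaban, CMP 109 (1987) 249–301 [Balaban1987RG1] ((0.4), (0.11) p.253); CMP 95 (1984) 17–40 [Balaban1984PropagatorsI] ((1.7) p.18).
-/

noncomputable section

open scoped BigOperators Matrix.Norms.L2Operator

namespace Summit.QuantumFields.YangMills.Theorems.Prop7TowerStraightTransport

open Literature.MathematicalPhysics.QuantumFieldTheory.Balaban1983to89
open Finset T4Continuum BlockAveraging AveragingRT ExpMeanLog BlockAveragingEMLProp2
open B15DeterminingSets (embIter)
open Summit.QuantumFields.YangMills.Theorems.Prop7HolRatioPerStep (norm_coe_eq_one)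
open Summit.QuantumFields.YangMills.Theorems.Prop7FlatHolonomy (holAt_walk_of_straightIter flatMap_replicate_replicate holAt_walk_single_true)

variable {P : Params} {n : Type*} [Fintype n] [DecidableEq n] [Nonempty n] {j : ℕ}

/-! ## §1 Products of unitaries: the straight-walk telescoping -/

/-- **STRAIGHT-WALK TELESCOPING**: for two `SU(N)` fields `A`, `B` on the same lattice, `‖A([x → m steps e_μ]) − B([x → m steps e_μ])‖ ≤ Σ_{t<m}‖A(x+te_μ, μ) − B(x+te_μ, μ)‖`.
[folklore] -/
theorem norm_holAt_walk_replicate_sub_le (A B : GaugeField P j (Matrix.specialUnitaryGroup n ℂ)) (μ : Fin P.d) :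
    ∀ (m : ℕ) (x : Site P j),
      ‖((holAt A (walk x (List.replicate m (μ, true))) : Matrix.specialUnitaryGroup n ℂ) : Matrix n n ℂ)
          - ((holAt B (walk x (List.replicate m (μ, true))) : Matrix.specialUnitaryGroup n ℂ) : Matrix n n ℂ)‖
        ≤ ∑ t ∈ Finset.range m, ‖((A ⟨(fun z : Site P j => z.shift μ)^[t] x, μ⟩ : Matrix.specialUnitaryGroup n ℂ) : Matrix n n ℂ)
            - ((B ⟨(fun z : Site P j => z.shift μ)^[t] x, μ⟩ : Matrix.specialUnitaryGroup n ℂ) : Matrix n n ℂ)‖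
  | 0, x => by simp [walk, holAt_nil]
  | m + 1, x => by
    rw [List.replicate_succ, walk, holAt_cons, holAt_cons, Finset.sum_range_succ']
    simp only [if_true, Submonoid.coe_mul, Function.iterate_succ_apply, Function.iterate_zero_apply]
    have ih := norm_holAt_walk_replicate_sub_le A B μ m (x.shift μ)
    -- `‖ab − a′b′‖ ≤ ‖a − a′‖ + ‖b − b′‖` for `‖b‖, ‖a′‖ ≤ 1` (= the T⁴ support lemma `SkeletonPrecomp.norm_mul_sub_mul_le`, not importable here)
    have hprod : ∀ {a a' b b' : Matrix n n ℂ}, ‖b‖ ≤ 1 → ‖a'‖ ≤ 1 → ‖a * b - a' * b'‖ ≤ ‖a - a'‖ + ‖b - b'‖ := by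
      intro a a' b b' hb ha'
      have e : a * b - a' * b' = (a - a') * b + a' * (b - b') := by noncomm_ring
      rw [e]
      calc _ ≤ ‖a - a'‖ * ‖b‖ + ‖a'‖ * ‖b - b'‖ := (norm_add_le _ _).trans (add_le_add (norm_mul_le _ _) (norm_mul_le _ _))
        _ ≤ ‖a - a'‖ * 1 + 1 * ‖b - b'‖ := add_le_add (mul_le_mul_of_nonneg_left hb (norm_nonneg _)) (mul_le_mul_of_nonneg_right ha' (norm_nonneg _))
        _ = ‖a - a'‖ + ‖b - b'‖ := by ring
    calc _ ≤ ‖((A ⟨x, μ⟩ : Matrix.specialUnitaryGroup n ℂ) : Matrix n n ℂ) - ((B ⟨x, μ⟩ : Matrix.specialUnitaryGroup n ℂ) : Matrix n n ℂ)‖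
          + ‖((holAt A (walk (x.shift μ) (List.replicate m (μ, true))) : Matrix.specialUnitaryGroup n ℂ) : Matrix n n ℂ)
            - ((holAt B (walk (x.shift μ) (List.replicate m (μ, true))) : Matrix.specialUnitaryGroup n ℂ) : Matrix n n ℂ)‖ :=
          hprod (norm_coe_eq_one _).le (norm_coe_eq_one _).le
      _ ≤ _ := by rw [add_comm]; exact add_le_add ih le_rfl

/-! ## §2 ★★ The tower's bond variables versus the fine straight transporters -/

/-- ★★ **`Ū₀^{(k)}(c)` IS THE FINE STRAIGHT TRANSPORTER UP TO `θ_k`.**  Tower `Ū₀^{(j)} = Averaging.iter (blockAvg ℰp) j U₀`; per-level loop-variable sizes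
`dist1(W^{(j)}_i(c)) ≤ a j ≤ 1/6`, `a j < δ_N` (`j < k`); any `θ` with `0 ≤ θ 0` and `2·a j + L·θ j ≤ θ (j+1)` (`j < k`).  Then for every level-`k` bond `c`,
`‖Ū₀^{(k)}(c) − U₀([embIter k c₋ → L^k steps e_c])‖ ≤ θ k`.  (`κ`-factor `dist1_corr_le_two_mul` + straight-walk telescoping, along ★p1's `holAt_walk_of_straightIter`.)
[cite: Balaban1987RG1, (0.4) and (0.11) p.253] -/
theorem norm_iter_sub_straightIter_le (U₀ : GaugeField P 0 (Matrix.specialUnitaryGroup n ℂ)) (a θ : ℕ → ℝ) (hθ0 : 0 ≤ θ 0)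
    (hθ : ∀ j, 2 * a j + P.L * θ j ≤ θ (j + 1)) :
    ∀ k : ℕ, (∀ j < k, ∀ (c : PBond P (j + 1)) (i : Idx P),
        dist1 (loopHol (Averaging.iter (fun i => blockAvg (P := P) (j := i) (expMeanLogSU (n := n))) j U₀) c i) ≤ a j) →
      (∀ j < k, a j ≤ 1 / 6) → (∀ j < k, a j < deltaSU n) →
      ∀ c : PBond P k,
        ‖((Averaging.iter (fun i => blockAvg (P := P) (j := i) (expMeanLogSU (n := n))) k U₀ c : Matrix.specialUnitaryGroup n ℂ) : Matrix n n ℂ)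
            - ((holAt U₀ (walk (embIter k c.src) (List.replicate (P.L ^ k) (c.dir, true))) : Matrix.specialUnitaryGroup n ℂ) : Matrix n n ℂ)‖
          ≤ θ k := by
  intro k
  induction k with
  | zero =>
    intro _ _ _ c
    have h1 : holAt U₀ (walk (embIter 0 c.src) (List.replicate (P.L ^ 0) (c.dir, true))) = U₀ c := by
      rw [pow_zero]
      exact holAt_walk_single_true U₀ c.src c.dir
    have h0 : Averaging.iter (fun i => blockAvg (P := P) (j := i) (expMeanLogSU (n := n))) 0 U₀ = U₀ := rfl
    rw [h0, h1, sub_self, norm_zero]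
    exact hθ0
  | succ k ih =>
    intro hα h6 hN c
    have ih' := ih (fun j hj => hα j (Nat.lt_succ_of_lt hj)) (fun j hj => h6 j (Nat.lt_succ_of_lt hj)) (fun j hj => hN j (Nat.lt_succ_of_lt hj))
    set V := Averaging.iter (fun i => blockAvg (P := P) (j := i) (expMeanLogSU (n := n))) k U₀ with hV
    -- the straight transporter field at level `k` (written out) obeys the `κ`-free recursion
    have hW : holAt U₀ (walk (embIter (k + 1) c.src) (List.replicate (P.L ^ (k + 1)) (c.dir, true)))
        = holAt (fun c' : PBond P k => holAt U₀ (walk (embIter k c'.src) (List.replicate (P.L ^ k) (c'.dir, true))))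
            (walk (emb c.src) (List.replicate P.L (c.dir, true))) := by
      rw [holAt_walk_of_straightIter U₀ k (emb c.src), flatMap_replicate_replicate, ← pow_succ']
      rfl
    -- the tower's recursion
    have hiter : Averaging.iter (fun i => blockAvg (P := P) (j := i) (expMeanLogSU (n := n))) (k + 1) U₀ c
        = corr (expMeanLogSU (n := n)) V c * axialAvg V c := rfl
    rw [hiter, hW, Submonoid.coe_mul, axialAvg_eq_holAt_walk]
    -- `‖κ·X − Y‖ ≤ ‖κ − 1‖·‖X‖ + ‖X − Y‖`
    set κ : Matrix n n ℂ := ((corr (expMeanLogSU (n := n)) V c : Matrix.specialUnitaryGroup n ℂ) : Matrix n n ℂ) with hκ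
    set X : Matrix n n ℂ := ((holAt V (walk (emb c.src) (List.replicate P.L (c.dir, true))) : Matrix.specialUnitaryGroup n ℂ) : Matrix n n ℂ) with hX
    set Yw : Matrix n n ℂ := ((holAt (fun c' : PBond P k => holAt U₀ (walk (embIter k c'.src) (List.replicate (P.L ^ k) (c'.dir, true))))
            (walk (emb c.src) (List.replicate P.L (c.dir, true))) : Matrix.specialUnitaryGroup n ℂ) : Matrix n n ℂ) with hYw
    have hκ1 : ‖κ - 1‖ ≤ 2 * a k := by
      rw [hκ, ← FederbushMean.dist1_SU_eq]
      exact dist1_corr_le_two_mul V c (hα k (Nat.lt_succ_self k) c) (hN k (Nat.lt_succ_self k)) (h6 k (Nat.lt_succ_self k))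
    have hXY : ‖X - Yw‖ ≤ P.L * θ k := by
      have h := norm_holAt_walk_replicate_sub_le V
        (fun c' : PBond P k => holAt U₀ (walk (embIter k c'.src) (List.replicate (P.L ^ k) (c'.dir, true)))) c.dir P.L (emb c.src)
      refine h.trans ?_
      calc ∑ t ∈ Finset.range P.L, ‖((V ⟨(fun z : Site P k => z.shift c.dir)^[t] (emb c.src), c.dir⟩ : Matrix.specialUnitaryGroup n ℂ) : Matrix n n ℂ)
              - ((holAt U₀ (walk (embIter k (⟨(fun z : Site P k => z.shift c.dir)^[t] (emb c.src), c.dir⟩ : PBond P k).src)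
                  (List.replicate (P.L ^ k) ((⟨(fun z : Site P k => z.shift c.dir)^[t] (emb c.src), c.dir⟩ : PBond P k).dir, true))) :
                    Matrix.specialUnitaryGroup n ℂ) : Matrix n n ℂ)‖
          ≤ ∑ _t ∈ Finset.range P.L, θ k := Finset.sum_le_sum fun t _ => ih' _
        _ = P.L * θ k := by rw [Finset.sum_const, Finset.card_range, nsmul_eq_mul]
    have e : κ * X - Yw = (κ - 1) * X + (X - Yw) := by noncomm_ring
    rw [e]
    calc ‖(κ - 1) * X + (X - Yw)‖ ≤ ‖κ - 1‖ * ‖X‖ + ‖X - Yw‖ := (norm_add_le _ _).trans (add_le_add (norm_mul_le _ _) le_rfl)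
      _ ≤ 2 * a k * 1 + P.L * θ k := by
          rw [hX, norm_coe_eq_one]
          exact add_le_add (mul_le_mul_of_nonneg_right hκ1 zero_le_one) hXY
      _ ≤ θ (k + 1) := by have := hθ k; linarith

end Summit.QuantumFields.YangMills.Theorems.Prop7TowerStraightTransport

end
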